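import Literature.NumberTheory.ComplexMultiplication.BalancedTransversalOfCorankOne
import HarnessLib

/-!
# Kubota's defect space: null sets of balanced anti-invariant weights (rank of CM types on twelve embeddings, I)

Abstract setting of `CMTypeRank.lean` (`G` acting on the finite set `E` of embeddings, central fixed-point-free
involution `ρ`, CM type `Φ`, `IsCMTypeWith ρ Φ`, rank `typeRank G Φ`).  First of five files proving that a
PRIMITIVE CM type on `|E| = 12` embeddings has rank `≥ 6` (`RankAtLeastSix.lean`, where the whole
argument is described).  Everything PROVED; no definition, no named fact (D-0014/D-0026).

Contents: a balanced `ρ`-anti-invariant weight sums to zero over every translate `g⁻¹Φ`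
(`sum_mul_translateInd_eq_zero`); for a `G`-stable space `M ≠ 0` of such weights on a transitive `G`-set no point
is `M`-null (`exists_apply_ne_zero`); translates are determined by their trace on `Φ`
(`forall_smul_mem_iff_of_forall_mem`, sign vectors `antiVec_eq_of_forall_iff`); `|Φ|·2 = |E|`; for every `g` both
`Φ ∩ g⁻¹Φ` and `Φ ∖ g⁻¹Φ` are `M`-null (`sum_filter_filter_eq_zero`); when the values of `M` separate points, an
`M`-null subset of `Φ` has neither one nor two elements and two `M`-null `3`-subsets of `Φ` with null complements
are equal or complementary (`eq_or_eq_sdiff_of_null`).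

## References (held texts)

* B. Dodson, *On the Mumford–Tate group of an abelian variety with complex multiplication*, J. Algebra 111 (1987)
  [Dodson1987] (`paper:doi-10-1016-0021-8693-87-90242-0`), p0003 Thm. 1.0, Thm. 1.4; p0004 Cor. 1.5.
* T. Kubota, Trans. AMS 118 (1965) [Kubota1965], §4 (defect).  K. A. Ribet, Mém. SMF 2 (1980) [Ribet1980], §3 (3.5).
* B. B. Gordon, *A survey of the Hodge conjecture for abelian varieties* [Gordon1999HodgeAVSurvey], §9.2 (9.2.1), 9.4.
-/

noncomputable section

open scoped BigOperators Pointwise Classical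

namespace Summit.HodgeConjecture.CorCM.CMSixfoldRank

open Literature.NumberTheory.ComplexMultiplication
open Literature.NumberTheory.ComplexMultiplication.IsCMTypeWith

variable {G : Type*} [Group G] {E : Type*} [MulAction G E]

variable {ρ : G} {Φ : Set E} (h : IsCMTypeWith ρ Φ)
include h

section Finite

variable [Fintype E]

/-! ### Balanced anti-invariant weights vanish on every translate -/

/-- A `ρ`-anti-invariant weight has total mass `0`. [folklore] -/
theorem sum_eq_zero_of_anti' {μ : E → ℚ} (hanti : ∀ x, μ (ρ • x) = -μ x) : ∑ x, μ x = 0 := by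
  have hb : Function.Bijective fun x : E => ρ • x :=
    ⟨fun x y hxy => by simpa [h.invol] using congrArg (fun z => ρ • z) hxy, fun y => ⟨ρ • y, h.invol y⟩⟩
  have h1 : ∑ x, μ (ρ • x) = ∑ x, μ x := hb.sum_comp μ
  simp only [hanti, Finset.sum_neg_distrib] at h1
  linarith

/-- **A balanced `ρ`-anti-invariant weight sums to zero over every translate `g⁻¹Φ = {x | g•x ∈ Φ}`**:
`Σ_x μ(x)·[g•x ∈ Φ] = 0` (Pohlmann's condition `2Σ_{gx∈Φ} μ = Σ μ` with `Σ μ = 0`). [cite: Gordon1999HodgeAVSurvey, §9.2 (9.2.1)] -/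
theorem sum_mul_translateInd_eq_zero {μ : E → ℚ} (hanti : ∀ x, μ (ρ • x) = -μ x) (hbal : IsBalanced G Φ μ)
    (g : G) : ∑ x, μ x * translateInd Φ g x = 0 := by
  have h0 := sum_eq_zero_of_anti' h hanti
  have h1 := hbal g
  rw [h0] at h1
  linarith

/-- The same, as a sum over the finset `{x | g • x ∈ Φ}`. [cite: Gordon1999HodgeAVSurvey, §9.2 (9.2.1)] -/
theorem sum_filter_eq_zero {μ : E → ℚ} (hanti : ∀ x, μ (ρ • x) = -μ x) (hbal : IsBalanced G Φ μ) (g : G) :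
    ∑ x ∈ Finset.univ.filter (fun x : E => g • x ∈ Φ), μ x = 0 := by
  have h1 := sum_mul_translateInd_eq_zero h hanti hbal g
  rw [Finset.sum_filter]
  have h2 : ∀ x : E, μ x * translateInd Φ g x = if g • x ∈ Φ then μ x else 0 := fun x => by
    by_cases hx : g • x ∈ Φ
    · rw [translateInd_of_mem hx, if_pos hx, mul_one]
    · rw [translateInd_of_not_mem hx, if_neg hx, mul_zero]
  simpa only [h2] using h1

end Finite

omit h in
/-- **No point is null for a non-zero `G`-stable space of weights on a transitive `G`-set**: if every `μ ∈ M`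
vanished at `x`, then (translating) every `μ ∈ M` would vanish everywhere. [folklore] -/
theorem exists_apply_ne_zero [MulAction.IsPretransitive G E] (M : Submodule ℚ (E → ℚ))
    (hMG : ∀ μ ∈ M, ∀ g : G, (fun x => μ (g • x)) ∈ M) (hM : M ≠ ⊥) (x : E) :
    ∃ μ ∈ M, μ x ≠ 0 := by
  by_contra hx
  push Not at hx
  apply hM
  rw [Submodule.eq_bot_iff]
  intro μ hμ
  funext y
  obtain ⟨g, rfl⟩ := MulAction.exists_smul_eq G x y
  exact hx _ (hMG μ hμ g)

omit h in
/-- Translating preserves equivalence: `μ(x) = μ(y)` for all `μ ∈ M` iff `μ(gx) = μ(gy)` for all `μ ∈ M`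
(`M` is `G`-stable). [folklore] -/
theorem forall_apply_smul_eq_iff (M : Submodule ℚ (E → ℚ))
    (hMG : ∀ μ ∈ M, ∀ g : G, (fun x => μ (g • x)) ∈ M) (g : G) (x y : E) :
    (∀ μ ∈ M, μ (g • x) = μ (g • y)) ↔ (∀ μ ∈ M, μ x = μ y) := by
  constructor
  · intro hxy μ hμ
    have h1 := hxy _ (hMG μ hμ g⁻¹)
    simpa only [smul_smul, inv_mul_cancel, one_smul] using h1
  · intro hxy μ hμ
    exact hxy _ (hMG μ hμ g)


/-! ### Transversals, sign vectors -/

/-- `x ∉ Φ` forces `ρx ∈ Φ`. [cite: Dodson1987, §1.1 (p. 50)] -/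
theorem rho_smul_mem_of_not_mem {x : E} (hx : x ∉ Φ) : ρ • x ∈ Φ := by
  by_contra hρ
  exact hx ((h.mem_iff x).2 hρ)

/-- Two translates containing the same elements of `Φ` are equal (extend from `Φ` to `E` through `ρ`). [folklore] -/
theorem forall_smul_mem_iff_of_forall_mem {g g' : G} (hΦ : ∀ x ∈ Φ, (g • x ∈ Φ ↔ g' • x ∈ Φ)) (x : E) :
    g • x ∈ Φ ↔ g' • x ∈ Φ := by
  by_cases hx : x ∈ Φ
  · exact hΦ x hx
  · have hρx : ρ • x ∈ Φ := rho_smul_mem_of_not_mem h hx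
    have h1 := hΦ _ hρx
    rw [h.comm g x, h.comm g' x, h.rho_smul_mem_iff, h.rho_smul_mem_iff] at h1
    exact not_iff_not.1 h1

/-- A translate containing exactly the elements of `Φ` missed by another is its complement. [folklore] -/
theorem forall_smul_mem_iff_not_of_forall_mem {g g' : G} (hΦ : ∀ x ∈ Φ, (g • x ∈ Φ ↔ g' • x ∉ Φ)) (x : E) :
    g • x ∈ Φ ↔ g' • x ∉ Φ := by
  by_cases hx : x ∈ Φ
  · exact hΦ x hx
  · have hρx : ρ • x ∈ Φ := rho_smul_mem_of_not_mem h hx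
    have h1 := hΦ _ hρx
    rw [h.comm g x, h.comm g' x, h.rho_smul_mem_iff, h.rho_smul_mem_iff, not_not] at h1
    constructor
    · intro h2 h3; exact h1.2 h3 h2
    · intro h2; by_contra h3; exact h2 (h1.1 h3)

omit h in
/-- Equal translates have equal sign vectors `u_g = 2·𝟙_{g⁻¹Φ} − 1`. [folklore] -/
theorem antiVec_eq_of_forall_iff {g g' : G} (hiff : ∀ x : E, g • x ∈ Φ ↔ g' • x ∈ Φ) :
    antiVec Φ g = antiVec Φ g' := by
  funext x
  simp only [antiVec]
  by_cases hx : g • x ∈ Φ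
  · rw [translateInd_of_mem hx, translateInd_of_mem ((hiff x).1 hx)]
  · rw [translateInd_of_not_mem hx, translateInd_of_not_mem (mt (hiff x).2 hx)]

omit h in
/-- Complementary translates have opposite sign vectors. [folklore] -/
theorem antiVec_eq_neg_of_forall_iff {g g' : G} (hiff : ∀ x : E, g • x ∈ Φ ↔ g' • x ∉ Φ) :
    antiVec Φ g = -antiVec Φ g' := by
  funext x
  simp only [antiVec, Pi.neg_apply]
  by_cases hx : g • x ∈ Φ
  · rw [translateInd_of_mem hx, translateInd_of_not_mem ((hiff x).1 hx)]; norm_num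
  · rw [translateInd_of_not_mem hx, translateInd_of_mem (not_not.1 (mt (hiff x).2 hx))]; norm_num

section Finite2

variable [Fintype E]

/-- `|Φ| · 2 = |E|`: `Φ` and `ρΦ` partition `E`. [cite: Dodson1987, §1.1 (p. 50)] -/
theorem card_filter_mem_mul_two : (Finset.univ.filter fun x : E => x ∈ Φ).card * 2 = Fintype.card E := by
  set A : Finset E := Finset.univ.filter fun x : E => x ∈ Φ with hA
  have hinj : Set.InjOn (fun x : E => ρ • x) ↑A := fun x _ y _ hxy => by
    simpa [h.invol] using congrArg (fun z => ρ • z) hxy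
  have hcard : (A.image fun x => ρ • x).card = A.card := Finset.card_image_of_injOn hinj
  have hdisj : Disjoint A (A.image fun x => ρ • x) := by
    rw [Finset.disjoint_left]
    intro x hx hx'
    obtain ⟨y, hy, rfl⟩ := Finset.mem_image.1 hx'
    simp only [hA, Finset.mem_filter, Finset.mem_univ, true_and] at hx hy
    exact (h.mem_iff y).1 hy hx
  have hunion : A ∪ A.image (fun x => ρ • x) = Finset.univ := by
    ext x
    simp only [Finset.mem_union, Finset.mem_univ, iff_true]
    by_cases hx : x ∈ Φ
    · exact Or.inl (by simpa [hA] using hx)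
    · refine Or.inr (Finset.mem_image.2 ⟨ρ • x, ?_, h.invol x⟩)
      simpa [hA] using rho_smul_mem_of_not_mem h hx
  have := Finset.card_union_of_disjoint hdisj
  rw [hunion, Finset.card_univ, hcard] at this
  omega

/-! ### Null sets for a space of balanced anti-invariant weights -/

/-- For a space `M` of balanced `ρ`-anti-invariant weights and any `g`, both `Φ ∩ g⁻¹Φ` and `Φ ∖ g⁻¹Φ` are
`M`-null: `Σ_Φ μ = 0 = Σ_{g⁻¹Φ} μ = Σ_{Φ ∩ g⁻¹Φ} μ − Σ_{Φ ∖ g⁻¹Φ} μ`. [cite: Gordon1999HodgeAVSurvey, §9.2 (9.2.1)] -/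
theorem sum_filter_filter_eq_zero (M : Submodule ℚ (E → ℚ)) (hMa : ∀ μ ∈ M, ∀ x, μ (ρ • x) = -μ x)
    (hMb : ∀ μ ∈ M, IsBalanced G Φ μ) (g : G) {μ : E → ℚ} (hμ : μ ∈ M) :
    ∑ x ∈ (Finset.univ.filter fun x : E => x ∈ Φ).filter (fun x => g • x ∈ Φ), μ x = 0 ∧
      ∑ x ∈ (Finset.univ.filter fun x : E => x ∈ Φ).filter (fun x => g • x ∉ Φ), μ x = 0 := by
  set A : Finset E := Finset.univ.filter fun x : E => x ∈ Φ with hA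
  set P : Finset E := A.filter fun x => g • x ∈ Φ with hP
  set Q : Finset E := A.filter fun x => g • x ∉ Φ with hQ
  -- `Σ_Φ μ = Σ_P μ + Σ_Q μ = 0`
  have hΦ : ∑ x ∈ A, μ x = 0 := by
    have := sum_filter_eq_zero h (hMa μ hμ) (hMb μ hμ) 1
    simpa only [one_smul, hA] using this
  have hsplit : ∑ x ∈ A, μ x = ∑ x ∈ P, μ x + ∑ x ∈ Q, μ x :=
    (Finset.sum_filter_add_sum_filter_not A (fun x => g • x ∈ Φ) μ).symm
  -- `Σ_{g⁻¹Φ} μ = Σ_P μ + Σ_{ρQ} μ = Σ_P μ − Σ_Q μ = 0`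
  set T : Finset E := Finset.univ.filter fun x : E => g • x ∈ Φ with hT
  have hTsum : ∑ x ∈ T, μ x = 0 := sum_filter_eq_zero h (hMa μ hμ) (hMb μ hμ) g
  have hT1 : T.filter (fun x => x ∈ Φ) = P := by
    ext x; simp only [hT, hP, hA, Finset.mem_filter, Finset.mem_univ, true_and]; tauto
  have hT2 : T.filter (fun x => x ∉ Φ) = Q.image fun y => ρ • y := by
    ext x
    simp only [hT, hQ, hA, Finset.mem_filter, Finset.mem_univ, true_and, Finset.mem_image]
    constructor
    · rintro ⟨hgx, hx⟩
      refine ⟨ρ • x, ⟨rho_smul_mem_of_not_mem h hx, ?_⟩, h.invol x⟩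
      rw [h.comm, h.rho_smul_mem_iff, not_not]; exact hgx
    · rintro ⟨y, ⟨hy, hgy⟩, rfl⟩
      refine ⟨?_, (h.mem_iff y).1 hy⟩
      rw [h.comm, h.rho_smul_mem_iff]; exact hgy
  have hinj : Set.InjOn (fun y : E => ρ • y) ↑Q := fun x _ y _ hxy => by
    simpa [h.invol] using congrArg (fun z => ρ • z) hxy
  have hTsplit : ∑ x ∈ T, μ x = ∑ x ∈ P, μ x - ∑ x ∈ Q, μ x := by
    rw [← Finset.sum_filter_add_sum_filter_not T (fun x => x ∈ Φ) μ, hT1, hT2, Finset.sum_image hinj]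
    simp only [hMa μ hμ, Finset.sum_neg_distrib]
    ring
  constructor <;> linarith

end Finite2

omit h in
/-- An `M`-null set is not a singleton (no point is null). [folklore] -/
theorem false_of_sum_singleton [MulAction.IsPretransitive G E] (M : Submodule ℚ (E → ℚ))
    (hMG : ∀ μ ∈ M, ∀ g : G, (fun x => μ (g • x)) ∈ M) (hM : M ≠ ⊥) {A : Finset E} (hA1 : A.card = 1)
    (hA : ∀ μ ∈ M, ∑ x ∈ A, μ x = 0) : False := by
  obtain ⟨a, rfl⟩ := Finset.card_eq_one.1 hA1
  obtain ⟨μ, hμ, hμa⟩ := exists_apply_ne_zero M hMG hM a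
  exact hμa (by simpa using hA μ hμ)


/-- An `M`-null subset of `Φ` does not have two elements when the values of `M` separate points: `μ(a) = −μ(b) =
μ(ρb)` for all `μ` would force `a = ρb ∉ Φ`. [folklore] -/
theorem false_of_card_eq_two (M : Submodule ℚ (E → ℚ)) (hMa : ∀ μ ∈ M, ∀ x, μ (ρ • x) = -μ x)
    (hinj : ∀ x y : E, (∀ μ ∈ M, μ x = μ y) → x = y) {A : Finset E} (hAΦ : ∀ x ∈ A, x ∈ Φ)
    (hA2 : A.card = 2) (hA : ∀ μ ∈ M, ∑ x ∈ A, μ x = 0) : False := by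
  obtain ⟨a, b, hab, rfl⟩ := Finset.card_eq_two.1 hA2
  have hsame : ∀ μ ∈ M, μ a = μ (ρ • b) := fun μ hμ => by
    have h1 := hA μ hμ
    rw [Finset.sum_pair hab] at h1
    rw [hMa μ hμ]
    linarith
  have hab' := hinj a (ρ • b) hsame
  have ha : a ∈ Φ := hAΦ a (by simp)
  have hb : b ∈ Φ := hAΦ b (by simp)
  rw [hab'] at ha
  exact (h.mem_iff b).1 hb ha

omit h in
/-- Two `M`-null sets of the same size do not differ by exactly one element (when the values of `M` separate
points): the two differing elements would take the same values. [folklore] -/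
theorem false_of_card_sdiff_eq_one (M : Submodule ℚ (E → ℚ))
    (hinj : ∀ x y : E, (∀ μ ∈ M, μ x = μ y) → x = y) {A B : Finset E}
    (hA : ∀ μ ∈ M, ∑ x ∈ A, μ x = 0) (hB : ∀ μ ∈ M, ∑ x ∈ B, μ x = 0) (hcard : A.card = B.card)
    (h1 : (A \ B).card = 1) : False := by
  have h1' : (B \ A).card = 1 := by
    have ha := Finset.card_sdiff_add_card_inter A B
    have hb := Finset.card_sdiff_add_card_inter B A
    rw [Finset.inter_comm] at hb
    omega
  obtain ⟨c, hc⟩ := Finset.card_eq_one.1 h1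
  obtain ⟨d, hd⟩ := Finset.card_eq_one.1 h1'
  have hsame : ∀ μ ∈ M, μ c = μ d := by
    intro μ hμ
    have ha : ∑ x ∈ A \ (A ∩ B), μ x + ∑ x ∈ A ∩ B, μ x = ∑ x ∈ A, μ x :=
      Finset.sum_sdiff Finset.inter_subset_left
    have hb : ∑ x ∈ B \ (A ∩ B), μ x + ∑ x ∈ A ∩ B, μ x = ∑ x ∈ B, μ x :=
      Finset.sum_sdiff Finset.inter_subset_right
    have e1 : A \ (A ∩ B) = A \ B := by
      ext x; simp only [Finset.mem_sdiff, Finset.mem_inter]; tauto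
    have e2 : B \ (A ∩ B) = B \ A := by
      ext x; simp only [Finset.mem_sdiff, Finset.mem_inter]; tauto
    rw [e1, hc, Finset.sum_singleton, hA μ hμ] at ha
    rw [e2, hd, Finset.sum_singleton, hB μ hμ] at hb
    linarith
  have hcd : c = d := hinj c d hsame
  have hcA : c ∈ A \ B := by rw [hc]; exact Finset.mem_singleton_self c
  have hdB : d ∈ B \ A := by rw [hd]; exact Finset.mem_singleton_self d
  rw [Finset.mem_sdiff] at hcA hdB
  exact hcA.2 (hcd ▸ hdB.1)

omit h in
/-- **Two `M`-null `3`-subsets of a `6`-set with null complements are equal or complementary** (values of `M`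
separating points): by the size `k` of their difference — `k = 1` is excluded by the previous lemma, `k = 2` is
`k = 1` for the complement. [folklore] -/
theorem eq_or_eq_sdiff_of_null (M : Submodule ℚ (E → ℚ))
    (hinj : ∀ x y : E, (∀ μ ∈ M, μ x = μ y) → x = y) {Φf A B : Finset E} (hAΦ : A ⊆ Φf) (hBΦ : B ⊆ Φf)
    (hA : ∀ μ ∈ M, ∑ x ∈ A, μ x = 0) (hB : ∀ μ ∈ M, ∑ x ∈ B, μ x = 0)
    (hB' : ∀ μ ∈ M, ∑ x ∈ Φf \ B, μ x = 0)
    (hcA : A.card = 3) (hcB : B.card = 3) (hcΦ : Φf.card = 6) : A = B ∨ A = Φf \ B := by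
  have hk : (A \ B).card ≤ 3 := hcA ▸ Finset.card_le_card Finset.sdiff_subset
  have hcB' : (Φf \ B).card = 3 := by
    have h1 := Finset.card_sdiff_add_card_inter Φf B
    rw [Finset.inter_eq_right.2 hBΦ] at h1
    omega
  have hAB := Finset.card_sdiff_add_card_inter A B
  obtain ⟨k, hk'⟩ : ∃ k, (A \ B).card = k := ⟨_, rfl⟩
  rw [hk'] at hk hAB
  interval_cases k
  · left
    have hsub : A ⊆ B := by
      intro x hx
      by_contra hxB
      have hx' : x ∈ A \ B := Finset.mem_sdiff.2 ⟨hx, hxB⟩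
      rw [Finset.card_eq_zero.1 hk'] at hx'
      exact Finset.notMem_empty x hx'
    exact Finset.eq_of_subset_of_card_le hsub (by omega)
  · exact (false_of_card_sdiff_eq_one M hinj hA hB (by omega) hk').elim
  · exfalso
    refine false_of_card_sdiff_eq_one M hinj hA hB' (by omega) ?_
    have e : A \ (Φf \ B) = A ∩ B := by
      ext x
      simp only [Finset.mem_sdiff, Finset.mem_inter, not_and, not_not]
      constructor
      · rintro ⟨hxA, hx⟩; exact ⟨hxA, hx (hAΦ hxA)⟩
      · rintro ⟨hxA, hxB⟩; exact ⟨hxA, fun _ => hxB⟩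
    rw [e]
    omega
  · right
    have hsub : A ⊆ Φf \ B := by
      intro x hxA
      refine Finset.mem_sdiff.2 ⟨hAΦ hxA, fun hxB => ?_⟩
      have hx' : x ∈ A ∩ B := Finset.mem_inter.2 ⟨hxA, hxB⟩
      have h0 : (A ∩ B).card = 0 := by omega
      rw [Finset.card_eq_zero.1 h0] at hx'
      exact Finset.notMem_empty x hx'
    exact Finset.eq_of_subset_of_card_le hsub (by omega)

end Summit.HodgeConjecture.CorCM.CMSixfoldRank

end
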